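import Mathlib
import HarnessLib
import Summits.BirchSwinnertonDyer.BirchSwinnertonDyer.Theses.ByReductionTypeAtTwo
import Literature.NumberTheory.EllipticCurves.HeegnerPoints
import Literature.NumberTheory.EllipticCurves.HeegnerPointsOfConductor
import Literature.NumberTheory.EllipticCurves.ModularCurveEtaQuotientsProofs

/-!
# Sketch — crux ideas for `RankOneAtTwoOffBigImageOddLocal` (stmt-BirchSwinnertonDyer-23716), ideator 2/2

First-lemma signatures only (nothing proved, nothing asserted as true):

* `EisensteinKummerGenus` (card A, TYPE A = rational 2-torsion): the φ-Kummer class of the Heegner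
  point is the norm of a cuspidal-unit (η-quotient) CM value; genus theory decides its square class.
* `ShiftedKolyvaginBigImage` (card B, TYPE C = surjective 2-adic image, even Tamagawa): the
  Tamagawa-shifted divisibility of Heegner / derived points at `p = 2`.
-/

set_option autoImplicit false

noncomputable section

open scoped Classical

open Literature.NumberTheory.EllipticCurves Literature.NumberTheory.EllipticCurves.ModularForms

namespace Summit.BirchSwinnertonDyer.BirchSwinnertonDyer.Cruxes.RankOneAtTwoOffBigImageOddLocal

namespace EisensteinKummerGenus

/-- `x(P) − e` for an affine point `P` of `W` over a `ℚ`-algebra `F` (junk value `1` at `O`):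
for `P ∉ {O, T}` this is the value of the `φ`-descent (Kummer) map `E(F) → F^×/F^{×2}` attached to
the 2-isogeny `φ` with kernel `⟨T⟩`, `T = (e, ·)` (Silverman AEC X.4.9). -/
def xSubE (F : Type) [Field F] [Algebra ℚ F] (W : WeierstrassCurve ℚ) (e : ℚ) :
    (W.baseChange F).toAffine.Point → F
  | .zero => 1
  | .some x _ _ => x - algebraMap ℚ F e

/-- `δ_φ(T) = (e − e')(e − e'') = ψ₂'(e)/4` for `ψ₂ = 4x³ + b₂x² + 2b₄x + b₆` (the Kummer class of
the 2-torsion point itself, AEC X.4.9). -/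
def deltaT (W : WeierstrassCurve ℚ) (e : ℚ) : ℚ := 3 * e ^ 2 + W.b₂ / 2 * e + W.b₄ / 2

/-- **L1 (CM value law for cuspidal units).** The value of an `η`-quotient modular unit of level
`N` (Newman/Ligozat conditions) at the Heegner point `τ₁ = x(1)` of `(𝓞_K, 𝔫)` lies in the Hilbert
class field `K[1] ⊂ ℂ` (Shimura reciprocity; Gross 1984 §4 for `t = (η(τ)/η(Nτ))^{24/m}`). -/
def EtaValueInHilbertClassField : Prop :=
  ∀ (N : ℕ) [NeZero N] (K : Type) [Field K] [NumberField K], IsImaginaryQuadratic K →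
    ∀ (ι : K →+* ℂ) (β : ℤ), (4 * N : ℤ) ∣ β ^ 2 - NumberField.discr K →
    ∀ (r : ℕ → ℤ), NewmanCond N r 0 →
      etaQuotient N r (heegnerPointOfConductor (NumberField.discr K) β 1) ∈ ringClassField K ι 1

/-- **FIRST LEMMA of card A (η-norm indivisibility criterion, the "generalised Birch–Tian lemma"
for non-CM type-A curves).**  `W` non-CM of analytic rank `1` with a rational 2-torsion point
`T = (e,·)`; `K` Heegner, `d_K < −4`; `Dt` an `X₀(N)`-optimal datum; `d₁` the level-1
Kolyvagin–Heegner datum (`y(1) ∈ E(K[1])`, `P(1) = Tr y(1) = y_K`), `y_K` non-torsion;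
`E(K)[2^∞] = ⟨T⟩`; `G = ∏ η(δτ)^{r_δ}` a modular unit with `x(y(1)) − e = G(τ₁) · h²`, `h ∈ K[1]`
(the evaluated CUSPIDAL KUMMER REPRESENTATION of `ι(T) = π^*[(T)−(O)] ∈ J₀(N)[2]`);
`κ = N_{K[1]/K} G(τ₁) ∈ K`.  CLAIM: if neither `κ` nor `κ·δ_φ(T)` is a square in `K`, then `y_K`
is not twice a `K`-point modulo torsion (so `ord₂ [E(K) : ℤ y_K] = ord₂ #E(K)_tors`, the index
input of the `p = 2` door at its floor).  Mechanism: `δ_φ(y_K) = cor_{K[1]/K} δ_φ(y(1)) =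
[N(x(y(1)) − e)] = [κ]·[N h]² ∈ K^×/K^{×2}`. -/
def EtaNormIndivisibilityCriterion : Prop :=
  ∀ (W : WeierstrassCurve ℚ) [W.IsElliptic] [W.IsGloballyMinimal] [NeZero (W.conductorNorm ℤ)],
    ¬ W.HasCM → W.analyticRank = 1 →
    ∀ (e : ℚ), W.twoTorsionPolynomial.toPoly.IsRoot e →
    ∀ (K : Type) [Field K] [NumberField K], IsImaginaryQuadratic K → NumberField.discr K < -4 →
      SatisfiesHeegnerHypothesis (W.conductorNorm ℤ) K →
    ∀ (Dt : ModularParametrizationData W (W.conductorNorm ℤ)),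
      (∀ z ∈ Dt.L.lattice, ∃ w ∈ periodLattice Dt.f, z = (Dt.c : ℂ) * w) →
    ∀ (β : ℤ) (ι : K →+* ℂ) (d₁ : KolyvaginHeegnerData Dt β ι 1),
      ¬ IsOfFinAddOrder d₁.derivedPoint →
      padicValNat 2 (W.baseChange K).torsionOrder = 1 →
    ∀ (r : ℕ → ℤ), NewmanCond (W.conductorNorm ℤ) r 0 →
    ∀ (hmem : etaQuotient (W.conductorNorm ℤ) r
        (heegnerPointOfConductor (NumberField.discr K) β 1) ∈ ringClassField K ι 1),
      (∃ h : ringClassField K ι 1,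
        xSubE (ringClassField K ι 1) W e d₁.y = ⟨_, hmem⟩ * h ^ 2) →
    ∀ (κ : K), ι κ = ∏ s ∈ d₁.S, ((s ⟨_, hmem⟩ : ringClassField K ι 1) : ℂ) →
      ¬ IsSquare κ → ¬ IsSquare (κ * algebraMap ℚ K (deltaT W e)) →
    ∀ (P : (W.baseChange K).toAffine.Point),
      WeierstrassCurve.Affine.Point.map (algebraMap K (ringClassField K ι 1)).toRatAlgHom P =
        d₁.derivedPoint →
      ¬ ∃ Q : (W.baseChange K).toAffine.Point,
        P - (2 : ℤ) • Q ∈ AddCommGroup.torsion (W.baseChange K).toAffine.Point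

end EisensteinKummerGenus

namespace ShiftedKolyvaginBigImage

/-- **FIRST LEMMA of card B (Tamagawa divisibility of the Heegner point at `p = 2`, TYPE C).**
For `W` non-CM of analytic rank `1` with SURJECTIVE `2`-adic image (so `E(K)[2] = 0` and the
rational torsion translating `y` onto the identity component, Gross–Zagier III (3.1), has ODD
order), every Heegner point `y_K` over a Heegner field `K` is `2^t`-divisible in `E(K)` modulo
torsion, `t = v₂(∏_ℓ c_ℓ(E/ℚ))` — the `n = 1`, SUM-over-`ℓ` form of Jetchev's Cor. 1.5 at the
excluded prime `p = 2` (Jetchev proves `max_ℓ`, `p` odd, `p ∤ N`, `ρ̄` onto). -/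
def HeegnerPointTamagawaDivisibilityAtTwo : Prop :=
  ∀ (W : WeierstrassCurve ℚ) [W.IsElliptic] [W.IsGloballyMinimal] [NeZero (W.conductorNorm ℤ)],
    ¬ W.HasCM → (∀ n : ℕ, W.HasSurjectiveModNGaloisRep ((2 ^ n : ℕ) : ℤ)) → W.analyticRank = 1 →
    ∀ (K : Type) [Field K] [NumberField K], IsImaginaryQuadratic K → NumberField.discr K < -4 →
      SatisfiesHeegnerHypothesis (W.conductorNorm ℤ) K →
    ∀ (P : (W.baseChange K).toAffine.Point), IsHeegnerPoint (W.conductorNorm ℤ) W K P →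
      ¬ IsOfFinAddOrder P →
      ∃ Q : (W.baseChange K).toAffine.Point,
        P - ((2 ^ padicValNat 2 W.tamagawaProduct : ℕ) : ℤ) • Q ∈
          AddCommGroup.torsion (W.baseChange K).toAffine.Point

/-- **Second statement of card B (transfer of `RefinedKolyvaginAtInertTwo`'s (≥)-half to the
non-CM big-image habitat): Tamagawa-shifted divisibility of the derived points at `2`.**  Every
derived point `P(n)` (`n ≠ 1` squarefree, all `ℓ ∣ n` Kolyvagin primes for `(E, K, 2)`) is
`2^m`-divisible in `E(K[n])` for every `m ≤ min(M(n), t)`, `t = v₂(∏ c_ℓ)`. -/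
def DerivedPointTamagawaDivisibilityAtTwo : Prop :=
  ∀ (W : WeierstrassCurve ℚ) [W.IsElliptic] [W.IsGloballyMinimal] [NeZero (W.conductorNorm ℤ)],
    ¬ W.HasCM → (∀ n : ℕ, W.HasSurjectiveModNGaloisRep ((2 ^ n : ℕ) : ℤ)) → W.analyticRank = 1 →
    ∀ (K : Type) [Field K] [NumberField K], IsImaginaryQuadratic K → NumberField.discr K < -4 →
      SatisfiesHeegnerHypothesis (W.conductorNorm ℤ) K →
    ∀ (Dt : ModularParametrizationData W (W.conductorNorm ℤ)) (β : ℤ) (ι : K →+* ℂ)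
      (d₁ : KolyvaginHeegnerData Dt β ι 1), ¬ IsOfFinAddOrder d₁.derivedPoint →
    ∀ (n : ℕ) (d : KolyvaginHeegnerData Dt β ι n) (m : ℕ), Squarefree n → n ≠ 1 →
      (∀ ℓ ∈ n.primeFactors, Zhang2014.IsKolyvaginPrime (W.conductorNorm ℤ) W K 2 ℓ) →
      (m : ℕ∞) ≤ Zhang2014.levelIndex W 2 n → m ≤ padicValNat 2 W.tamagawaProduct →
      ∃ Q : (W.baseChange (ringClassField K ι n)).toAffine.Point, ((2 ^ m : ℕ) : ℤ) • Q = d.derivedPoint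

end ShiftedKolyvaginBigImage

/-- Sanity: the crux decl this sketch serves is in scope under its route name. -/
example : Prop := Summit.BirchSwinnertonDyer.BirchSwinnertonDyer.Theses.ByReductionTypeAtTwo.RankOneAtTwoOffBigImageOddLocal

end Summit.BirchSwinnertonDyer.BirchSwinnertonDyer.Cruxes.RankOneAtTwoOffBigImageOddLocal

end
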